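import Summits.QuantumFields.YangMills.Theorems.MirrorModularBoostsCurvatureBoostCovarianceRayPositivityCore
import Summits.QuantumFields.YangMills.Theorems.PencilRigidityNPointIsotropyMopupHelpers
import Literature.MathematicalPhysics.QuantumFieldTheory.OSLorentzInvariance
import Literature.MathematicalPhysics.QuantumFieldTheory.OSReconstructionNoE1
import Mathlib.Data.Fin.Tuple.Sort

/-!
# Stub 3d `stub_orbitLocalContinuation` — local orbit continuation from planar boost vectors

Line `boosts-inherit-mirrors` of the crux `MirrorModularBoosts.CurvatureBoostCovariance` (stmt-QuantumFields-9663),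
registered Stub 3d of the checked skeleton, proved VERBATIM (`stub_orbitLocalContinuation`).  For a one-species
family `S₁` on `ℝ⁴` with E2 along `e₀` and translations on `⁰𝒮` (`h : OSReconstructionNoE1 S₁.toLabelled`) and E3,
IF uniform planar boost vectors are given (for every degree `n` a type `N` such that every compactly supported
`e₀`-time-ordered `F` has `V : ℂ → ℋ` holomorphic on `{|Re θ| < ε}`, `‖V θ‖ ≤ C e^{N |Im θ|}`, `V θ = Ψ_{R_θ F}` for
small real `θ`, `R_θ = planeRot 0 θ`), THEN in every degree `N` there is a type `Nₑ` (the same) such that for every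
compactly supported `X` with `e₀`-GENERIC support (pairwise distinct time coordinates, any order, any sign) the
orbit function `θ ↦ 𝔖_N(R_θ · X)` is, for `|θ| < ε`, the restriction of a function holomorphic on `{|Re w| < ε}`
bounded by `C e^{Nₑ |Im w|}`.

Proof.  (§1) The open time chambers `C_σ = {x⁰_{σ0} < x⁰_{σ1} < ⋯}` are pairwise disjoint and cover the
`e₀`-generic set (`Tuple.sort`, `Tuple.unique_monotone`); the indicator of a chamber times `X` is smooth
(`contDiff_indicator`), so `X = Σ_σ 1_{C_σ} X` with smooth compactly supported summands (`exists_chamber_pieces`).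
(§2–§3, `local_piece`) For a summand `Y` supported in `C_σ`: `permTest σ⁻¹ Y` is supported in the standard
chamber, and its translate by `(R+1) e₀` (`R` a bound of the support) is TIME-ORDERED and compactly supported; by
E3 and translation invariance on `⁰𝒮` all three have the same orbit function; small rotations keep the translate
time-ordered (landed `RayPositivity.exists_isTimeOrdered_planeRot`), so its orbit function is
`⟪Ω, Ψ_{R_w Z}⟫ = ⟪Ω, V(w)⟫` (`apply_eq_inner_vacuum`: `⟪Ψ_1, Ψ_Z⟫ = 𝔖_{0+N}(Θ1* ⊗ Z) = 𝔖_N(Z)`), holomorphic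
with `‖·‖ ≤ ‖Ω‖ C e^{Nₑ|Im w|}`.  (§4) Sum over `σ`.

References: K. Osterwalder, R. Schrader, Comm. Math. Phys. 31 (1973) §4.1 (the vectors `Ψ_F`, E3, translations);
folklore.  No `def`; helpers in the sub-namespace `OrbitBandlimitLocal`.
-/

noncomputable section

-- tree-known workaround (keep this line, it is in every landed Negative/*.lean file):
attribute [-instance] SimplexCategory.instFintypeToTypeOrderHomFinHAddNatLenOfNat

namespace Summit.QuantumFields.YangMills.Theorems.CurvatureBoostCovariance.BoostsInheritMirrors

open scoped BigOperators SchwartzMap InnerProductSpace ComplexConjugate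
open MeasureTheory Filter Topology
open Literature.MathematicalPhysics.QuantumLattice Literature.MathematicalPhysics.AQFT
  Literature.MathematicalPhysics.QuantumFieldTheory
open Summit.QuantumFields.YangMills.Theorems.NPointIsotropy.Negative (E4)
open Summit.QuantumFields.YangMills.Theorems.CurvatureBoostCovariance.Negative (isOffDiagonal_linActMulti)
open Summit.QuantumFields.YangMills.Theorems.NPointIsotropy.ComplexRotationBandlimit.Mopup (continuous_coord)

namespace OrbitBandlimitLocal

variable {N : ℕ}

/-! ## §1 Time chambers: open, disjoint, covering the `e₀`-generic set; the chamber decomposition -/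

/-- The open time chambers `C_σ = {x | x⁰_{σ 0} < x⁰_{σ 1} < ⋯}` are open. [folklore] -/
theorem isOpen_chamber (σ : Equiv.Perm (Fin N)) :
    IsOpen {x : Fin N → E4 | ∀ i j : Fin N, i < j → x (σ i) 0 < x (σ j) 0} := by
  simp only [Set.setOf_forall]
  refine isOpen_iInter_of_finite fun i => isOpen_iInter_of_finite fun j => ?_
  by_cases hij : i < j
  · simpa [hij] using isOpen_lt (continuous_coord (σ i) 0) (continuous_coord (σ j) 0)
  · simp [hij]

/-- Two chambers containing a common point coincide (uniqueness of the increasing enumeration). [folklore] -/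
theorem chamber_unique {x : Fin N → E4} {σ τ : Equiv.Perm (Fin N)}
    (hσ : ∀ i j : Fin N, i < j → x (σ i) 0 < x (σ j) 0)
    (hτ : ∀ i j : Fin N, i < j → x (τ i) 0 < x (τ j) 0) : σ = τ := by
  set t : Fin N → ℝ := fun i => x i 0 with ht
  have hσ' : StrictMono (t ∘ σ) := fun a b hab => hσ a b hab
  have hτ' : StrictMono (t ∘ τ) := fun a b hab => hτ a b hab
  have heq : t ∘ σ = t ∘ τ := Tuple.unique_monotone hσ'.monotone hτ'.monotone
  have hinj : Function.Injective t := by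
    intro a b hab
    have h1 : (t ∘ σ) (σ.symm a) = (t ∘ σ) (σ.symm b) := by simpa using hab
    simpa using hσ'.injective h1
  exact Equiv.ext fun i => hinj (congr_fun heq i)

/-- Every `e₀`-generic configuration lies in some chamber (sort the times). [folklore] -/
theorem exists_chamber {x : Fin N → E4} (hx : ∀ i j : Fin N, i ≠ j → x i 0 ≠ x j 0) :
    ∃ σ : Equiv.Perm (Fin N), ∀ i j : Fin N, i < j → x (σ i) 0 < x (σ j) 0 := by
  set t : Fin N → ℝ := fun i => x i 0 with ht
  have hinj : Function.Injective t := fun a b hab => by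
    by_contra h
    exact hx a b h hab
  exact ⟨Tuple.sort t, fun i j hij =>
    (Tuple.monotone_sort t).strictMono_of_injective (hinj.comp (Tuple.sort t).injective) hij⟩

/-- Indicators of open sets times smooth functions are smooth when the set is locally clopen along the support:
if every point of `tsupport f` outside `U` has a neighbourhood disjoint from `U`, then `1_U · f` is `C^n`.
[folklore] -/
theorem contDiff_indicator {E : Type*} [NormedAddCommGroup E] [NormedSpace ℝ E] {U : Set E} (hU : IsOpen U)
    {f : E → ℂ} {n : WithTop ℕ∞} (hf : ContDiff ℝ n f)
    (h : ∀ x ∈ tsupport f, x ∉ U → ∃ V ∈ 𝓝 x, Disjoint V U) : ContDiff ℝ n (U.indicator f) := by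
  refine contDiff_iff_contDiffAt.2 fun x => ?_
  by_cases hxU : x ∈ U
  · exact hf.contDiffAt.congr_of_eventuallyEq
      (Filter.eventually_of_mem (hU.mem_nhds hxU) fun y hy => Set.indicator_of_mem hy f)
  · have hzero : U.indicator f =ᶠ[𝓝 x] fun _ => 0 := by
      by_cases hxs : x ∈ tsupport f
      · obtain ⟨V, hV, hVU⟩ := h x hxs hxU
        exact Filter.eventually_of_mem hV fun y hy => Set.indicator_of_notMem (Set.disjoint_left.1 hVU hy) f
      · filter_upwards [notMem_tsupport_iff_eventuallyEq.1 hxs] with y hy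
        by_cases hyU : y ∈ U
        · rw [Set.indicator_of_mem hyU]; exact hy
        · exact Set.indicator_of_notMem hyU f
    exact (contDiffAt_const (c := (0 : ℂ))).congr_of_eventuallyEq hzero

/-- **Chamber decomposition.**  A compactly supported test function with `e₀`-generic support is the (finite) sum
of its restrictions to the time chambers, each smooth and compactly supported inside its chamber. [folklore] -/
theorem exists_chamber_pieces (X : 𝓢((Fin N → E4), ℂ)) (hXc : HasCompactSupport (X : (Fin N → E4) → ℂ))
    (hXs : tsupport (X : (Fin N → E4) → ℂ) ⊆ {x | ∀ i j : Fin N, i ≠ j → x i 0 ≠ x j 0}) :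
    ∃ Xs : Equiv.Perm (Fin N) → 𝓢((Fin N → E4), ℂ), X = ∑ σ, Xs σ ∧
      ∀ σ, HasCompactSupport (Xs σ : (Fin N → E4) → ℂ) ∧
        tsupport (Xs σ : (Fin N → E4) → ℂ) ⊆ {x | ∀ i j : Fin N, i < j → x (σ i) 0 < x (σ j) 0} := by
  set C : Equiv.Perm (Fin N) → Set (Fin N → E4) := fun σ =>
    {x | ∀ i j : Fin N, i < j → x (σ i) 0 < x (σ j) 0} with hC
  -- a point of the support outside `C σ` lies in another chamber, an open set disjoint from `C σ`
  have hloc : ∀ σ, ∀ x ∈ tsupport (X : (Fin N → E4) → ℂ), x ∉ C σ → ∃ V ∈ 𝓝 x, Disjoint V (C σ) := by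
    intro σ x hx hxσ
    obtain ⟨τ, hτ⟩ := exists_chamber (hXs hx)
    refine ⟨C τ, (isOpen_chamber τ).mem_nhds hτ, Set.disjoint_left.2 fun y hyτ hyσ => ?_⟩
    have : τ = σ := chamber_unique hyτ hyσ
    exact hxσ (this ▸ hτ)
  have hsupp : ∀ σ, Function.support ((C σ).indicator (X : (Fin N → E4) → ℂ)) ⊆
      Function.support (X : (Fin N → E4) → ℂ) := fun σ => by
    rw [Set.support_indicator]; exact Set.inter_subset_right
  have hcs : ∀ σ, HasCompactSupport ((C σ).indicator (X : (Fin N → E4) → ℂ)) := fun σ =>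
    HasCompactSupport.of_support_subset_isCompact hXc ((hsupp σ).trans (subset_tsupport _))
  have hsm : ∀ σ, ContDiff ℝ (⊤ : ℕ∞) ((C σ).indicator (X : (Fin N → E4) → ℂ)) := fun σ =>
    contDiff_indicator (isOpen_chamber σ) (X.smooth _) (hloc σ)
  refine ⟨fun σ => (hcs σ).toSchwartzMap (hsm σ), ?_, fun σ => ⟨hcs σ, ?_⟩⟩
  · ext x
    rw [_root_.sum_apply]
    show X x = ∑ σ, (C σ).indicator (X : (Fin N → E4) → ℂ) x
    by_cases hx0 : X x = 0
    · rw [hx0]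
      exact (Finset.sum_eq_zero fun σ _ => by simp [Set.indicator_apply, hx0]).symm
    · obtain ⟨σ₀, hσ₀⟩ := exists_chamber (hXs (subset_tsupport _ (Function.mem_support.2 hx0)))
      rw [Finset.sum_eq_single σ₀ (fun τ _ hτ => ?_) (fun h => absurd (Finset.mem_univ _) h),
        Set.indicator_of_mem (show x ∈ C σ₀ from hσ₀)]
      exact Set.indicator_of_notMem (show x ∉ C τ from fun hτx => hτ (chamber_unique hτx hσ₀)) _
  · intro x hx
    have hx2 : x ∈ tsupport ((C σ).indicator (X : (Fin N → E4) → ℂ)) := hx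
    by_contra hxσ
    obtain ⟨V, hV, hVd⟩ := hloc σ x (closure_mono (hsupp σ) hx2) hxσ
    obtain ⟨y, hyV, hy⟩ := mem_closure_iff_nhds.1 hx2 V hV
    exact Set.disjoint_left.1 hVd hyV (Set.support_indicator_subset hy)

/-! ## §2 Reordering and translating compactly supported test functions; the vacuum pairing -/

/-- Points of the support of `permTest π Y` are relabelled points of the support of `Y`. [folklore] -/
theorem mem_tsupport_of_permTest (π : Equiv.Perm (Fin N)) {Y : 𝓢((Fin N → E4), ℂ)} {y : Fin N → E4}
    (hy : y ∈ tsupport ((permTest π Y : 𝓢((Fin N → E4), ℂ)) : (Fin N → E4) → ℂ)) :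
    (y ∘ π) ∈ tsupport (Y : (Fin N → E4) → ℂ) := by
  have hfun : ((permTest π Y : 𝓢((Fin N → E4), ℂ)) : (Fin N → E4) → ℂ) =
      (Y : (Fin N → E4) → ℂ) ∘ fun y : Fin N → E4 => y ∘ π := by
    funext y; simp [permTest_apply]
  rw [hfun] at hy
  exact tsupport_comp_subset_preimage _ (continuous_pi fun i => continuous_apply (π i)) hy

/-- Label permutations preserve compact support. [folklore] -/
theorem hasCompactSupport_permTest (π : Equiv.Perm (Fin N)) {Y : 𝓢((Fin N → E4), ℂ)}
    (hY : HasCompactSupport (Y : (Fin N → E4) → ℂ)) :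
    HasCompactSupport ((permTest π Y : 𝓢((Fin N → E4), ℂ)) : (Fin N → E4) → ℂ) := by
  refine HasCompactSupport.intro
    (hY.image (continuous_pi fun i => continuous_apply (π.symm i)) :
      IsCompact ((fun y : Fin N → E4 => fun i => y (π.symm i)) '' tsupport (Y : (Fin N → E4) → ℂ)))
    fun y hy => ?_
  rw [permTest_apply]
  by_contra hne
  exact hy ⟨y ∘ π, subset_tsupport _ (Function.mem_support.2 hne), funext fun i => by simp⟩

/-- Translations preserve compact support. [folklore] -/
theorem hasCompactSupport_translateMulti (a : E4) {Y : 𝓢((Fin N → E4), ℂ)}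
    (hY : HasCompactSupport (Y : (Fin N → E4) → ℂ)) :
    HasCompactSupport ((translateMulti a Y : 𝓢((Fin N → E4), ℂ)) : (Fin N → E4) → ℂ) := by
  refine HasCompactSupport.intro
    (hY.image (continuous_pi fun i => (continuous_apply i).add continuous_const) :
      IsCompact ((fun y : Fin N → E4 => fun i => y i + a) '' tsupport (Y : (Fin N → E4) → ℂ)))
    fun y hy => ?_
  rw [translateMulti_apply]
  by_contra hne
  exact hy ⟨fun i => y i - a, subset_tsupport _ (Function.mem_support.2 hne), funext fun i => by simp⟩

/-- **`𝔖_N(Z) = ⟪Ω, Ψ_Z⟫`** for a time-ordered `Z`: the pairing of the vacuum generator `(0, ∅, 1)` with `(N, Z)` is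
`𝔖_{0+N}(Θ1* ⊗ Z) = 𝔖_N(Z)` (degree `0 + N` transported to degree `N`). [folklore] -/
theorem apply_eq_inner_vacuum {S₁ : SchwingerFamily E4} (h : OSReconstructionNoE1 S₁.toLabelled)
    {Z : 𝓢((Fin N → E4), ℂ)} (hZ : IsTimeOrdered Z) :
    S₁ N Z = ⟪h.vacuum, h.fieldVec N (fun _ => ()) Z hZ⟫_ℂ := by
  obtain ⟨H, hH⟩ := exists_isAppendTensorOf
    (osAdjoint (SchwartzMap.constOfSubsingleton (D := Fin 0 → E4) (1 : ℂ))) Z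
  have h1 := h.inner_fieldVec_fieldVec Fin.elim0 (fun _ => ())
    OSReconstructionNoE1.isTimeOrdered_constOfSubsingleton hZ hH
  have hvac : h.vacuum = h.fieldVec 0 Fin.elim0 (SchwartzMap.constOfSubsingleton (D := Fin 0 → E4) (1 : ℂ))
      OSReconstructionNoE1.isTimeOrdered_constOfSubsingleton := rfl
  rw [hvac, h1, SchwingerFamily.toLabelled_apply]
  -- transport along `0 + N = N`
  have key : ∀ {n n' : ℕ} (e : n = n') (H' : 𝓢((Fin n → E4), ℂ)) (Z' : 𝓢((Fin n' → E4), ℂ)),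
      (∀ x : Fin n → E4, H' x = Z' fun i => x (Fin.cast e.symm i)) → S₁ n H' = S₁ n' Z' := by
    intro n n' e H' Z' hH'
    subst e
    rw [show H' = Z' from SchwartzMap.ext fun x => by rw [hH' x]; simp]
  refine (key (Nat.zero_add N) H Z fun x => ?_).symm
  rw [hH x, osAdjoint_apply, SchwartzMap.constOfSubsingleton_apply, map_one, one_mul]
  exact congrArg Z (funext fun i => by simp only [Function.comp_apply, Fin.natAdd_zero])

/-! ## §3 One chamber piece: reorder, translate, boost vectors, vacuum pairing -/

/-- **Local continuation for a test function supported in ONE time chamber.**  Relabel to the standard chamber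
(E3), translate all times to positive values (translations), and pair the boosted vectors with the vacuum. -/
theorem local_piece {S₁ : SchwingerFamily E4} (h : OSReconstructionNoE1 S₁.toLabelled)
    (hsym : S₁.toLabelled.IsSymmetric) {Nₑ : ℝ}
    (hV : ∀ F : 𝓢((Fin N → E4), ℂ), IsTimeOrdered F → HasCompactSupport (F : (Fin N → E4) → ℂ) →
      ∃ ε : ℝ, 0 < ε ∧ ∃ (V : ℂ → h.Hilbert) (C : ℝ),
        DifferentiableOn ℂ V {θ : ℂ | |θ.re| < ε} ∧
        (∀ θ : ℂ, |θ.re| < ε → ‖V θ‖ ≤ C * Real.exp (Nₑ * |θ.im|)) ∧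
        ∀ θ : ℝ, |θ| < ε → ∀ hθ : IsTimeOrdered (linActMulti (planeRot (0 : Fin 3) θ) F),
          V θ = h.fieldVec N (fun _ => ()) (linActMulti (planeRot (0 : Fin 3) θ) F) hθ)
    (σ : Equiv.Perm (Fin N)) (Y : 𝓢((Fin N → E4), ℂ)) (hYc : HasCompactSupport (Y : (Fin N → E4) → ℂ))
    (hYs : tsupport (Y : (Fin N → E4) → ℂ) ⊆ {x | ∀ i j : Fin N, i < j → x (σ i) 0 < x (σ j) 0}) :
    ∃ ε : ℝ, 0 < ε ∧ ∃ (Φ : ℂ → ℂ) (C : ℝ), DifferentiableOn ℂ Φ {w : ℂ | |w.re| < ε} ∧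
      (∀ w : ℂ, |w.re| < ε → ‖Φ w‖ ≤ C * Real.exp (Nₑ * |w.im|)) ∧
      ∀ θ : ℝ, |θ| < ε → Φ θ = S₁ N (linActMulti (planeRot (0 : Fin 3) θ) Y) := by
  -- Step 1: relabel; `permTest σ⁻¹ Y` is supported in the standard chamber
  have hZ₀s : ∀ y ∈ tsupport ((permTest σ.symm Y : 𝓢((Fin N → E4), ℂ)) : (Fin N → E4) → ℂ),
      (y ∘ σ.symm) ∈ tsupport (Y : (Fin N → E4) → ℂ) ∧ ∀ i j : Fin N, i < j → y i 0 < y j 0 := by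
    intro y hy
    have hy' := mem_tsupport_of_permTest σ.symm hy
    exact ⟨hy', fun i j hij => by simpa using hYs hy' i j hij⟩
  have hZ₀c : HasCompactSupport ((permTest σ.symm Y : 𝓢((Fin N → E4), ℂ)) : (Fin N → E4) → ℂ) :=
    hasCompactSupport_permTest _ hYc
  have hZ₀off : IsOffDiagonal (permTest σ.symm Y) := by
    refine IsOffDiagonal.of_tsupport_subset fun y hy hyc => ?_
    obtain ⟨i, j, hij, hyij⟩ := hyc
    obtain ⟨-, hord⟩ := hZ₀s y hy
    rcases lt_or_gt_of_ne hij with hlt | hlt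
    · exact absurd (hyij ▸ hord i j hlt) (lt_irrefl _)
    · exact absurd (hyij ▸ hord j i hlt) (lt_irrefl _)
  -- Step 2: translate all times to positive values
  obtain ⟨R, hR⟩ : ∃ R : ℝ, ∀ x ∈ tsupport (Y : (Fin N → E4) → ℂ), ‖x‖ ≤ R := by
    obtain ⟨R, hR⟩ := hYc.isCompact.isBounded.subset_closedBall 0
    exact ⟨R, fun x hx => by simpa using hR hx⟩
  set a : E4 := (R + 1) • EuclideanSpace.single 0 1 with ha
  have ha0 : a 0 = R + 1 := by simp [ha]
  have hZc : HasCompactSupport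
      ((translateMulti a (permTest σ.symm Y) : 𝓢((Fin N → E4), ℂ)) : (Fin N → E4) → ℂ) :=
    hasCompactSupport_translateMulti _ hZ₀c
  have hZto : IsTimeOrdered (translateMulti a (permTest σ.symm Y)) := by
    intro y hy
    obtain ⟨huY, hord⟩ := hZ₀s _ (OSReconstructionNoE1.tsupport_translateMulti_subset a _ hy)
    have hcoord : ∀ i, (y i - a) 0 = y i 0 - (R + 1) := fun i => by simp [ha0]
    refine ⟨fun i => ?_, fun i j hij => ?_⟩
    · have hle : ‖y i - a‖ ≤ R := by
        rw [show y i - a = ((fun k => y k - a) ∘ ⇑σ.symm) (σ i) by simp]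
        exact (norm_le_pi_norm _ (σ i)).trans (hR _ huY)
      have h2 : |(y i - a) 0| ≤ R :=
        le_trans (by simpa [Real.norm_eq_abs] using PiLp.norm_apply_le (p := 2) (y i - a) 0) hle
      rw [hcoord] at h2
      linarith [(abs_le.1 h2).1]
    · have := hord i j hij
      simp only [hcoord] at this
      linarith
  -- Step 3: the orbit functions of `Y`, of the relabelled and of the translated function agree
  have horbY : ∀ w : ℝ, S₁ N (linActMulti (planeRot (0 : Fin 3) w) Y) =
      S₁ N (linActMulti (planeRot (0 : Fin 3) w) (permTest σ.symm Y)) := by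
    intro w
    have hperm : linActMulti (planeRot (0 : Fin 3) w) Y =
        permTest σ (linActMulti (planeRot (0 : Fin 3) w) (permTest σ.symm Y)) := by
      ext x; simp [linActMulti_apply, permTest_apply, Function.comp_def]
    rw [hperm]
    simpa using hsym N (fun _ => ()) σ (linActMulti (planeRot (0 : Fin 3) w) (permTest σ.symm Y))
      (isOffDiagonal_linActMulti hZ₀off _)
  have horbZ : ∀ w : ℝ, S₁ N (linActMulti (planeRot (0 : Fin 3) w) (translateMulti a (permTest σ.symm Y))) =
      S₁ N (linActMulti (planeRot (0 : Fin 3) w) (permTest σ.symm Y)) := by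
    intro w
    have htr : linActMulti (planeRot (0 : Fin 3) w) (translateMulti a (permTest σ.symm Y)) =
        translateMulti (planeRot (0 : Fin 3) w a) (linActMulti (planeRot (0 : Fin 3) w) (permTest σ.symm Y)) := by
      ext x; simp [linActMulti_apply, translateMulti_apply, map_sub]
    rw [htr]
    simpa using h.translationInvariant N (fun _ => ()) (planeRot (0 : Fin 3) w a)
      (linActMulti (planeRot (0 : Fin 3) w) (permTest σ.symm Y)) (isOffDiagonal_linActMulti hZ₀off _)
  -- Step 4: boost vectors, margin, vacuum pairing
  obtain ⟨ε, hε, V, C, hVd, hVg, hVv⟩ := hV _ hZto hZc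
  obtain ⟨δ, hδ, hTδ⟩ := RayPositivity.exists_isTimeOrdered_planeRot hZto hZc
  refine ⟨min ε δ, lt_min hε hδ, fun w => ⟪h.vacuum, V w⟫_ℂ, ‖h.vacuum‖ * C, ?_, ?_, ?_⟩
  · have h1 : DifferentiableOn ℂ V {w : ℂ | |w.re| < min ε δ} :=
      hVd.mono fun w (hw : |w.re| < min ε δ) => show |w.re| < ε from lt_of_lt_of_le hw (min_le_left _ _)
    exact ((innerSL ℂ h.vacuum).differentiable.comp_differentiableOn h1).congr fun w _ => by simp
  · intro w hw
    calc ‖⟪h.vacuum, V w⟫_ℂ‖ ≤ ‖h.vacuum‖ * ‖V w‖ := norm_inner_le_norm _ _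
      _ ≤ ‖h.vacuum‖ * (C * Real.exp (Nₑ * |w.im|)) :=
          mul_le_mul_of_nonneg_left (hVg w (lt_of_lt_of_le hw (min_le_left _ _))) (norm_nonneg _)
      _ = ‖h.vacuum‖ * C * Real.exp (Nₑ * |w.im|) := by ring
  · intro θ hθ
    have hto := hTδ θ (lt_of_lt_of_le hθ (min_le_right _ _))
    show ⟪h.vacuum, V θ⟫_ℂ = _
    rw [hVv θ (lt_of_lt_of_le hθ (min_le_left _ _)) hto, ← apply_eq_inner_vacuum h hto, horbZ θ, ← horbY θ]

/-! ## §4 Assembly: the local orbit continuation on `e₀`-generic compact supports -/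

/-- **Main form.**  Given E2 along `e₀` + translations (`h`), E3, and uniform planar boost vectors in degree `N`
with type `Nₑ`, every compactly supported `X` of degree `N` with `e₀`-generic support has an orbit function that
extends holomorphically near the angle `0` with type `Nₑ` (sum of `local_piece` over the chambers). -/
theorem localOrbitContinuation_main {S₁ : SchwingerFamily E4} (h : OSReconstructionNoE1 S₁.toLabelled)
    (hsym : S₁.toLabelled.IsSymmetric) {Nₑ : ℝ}
    (hV : ∀ F : 𝓢((Fin N → E4), ℂ), IsTimeOrdered F → HasCompactSupport (F : (Fin N → E4) → ℂ) →
      ∃ ε : ℝ, 0 < ε ∧ ∃ (V : ℂ → h.Hilbert) (C : ℝ),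
        DifferentiableOn ℂ V {θ : ℂ | |θ.re| < ε} ∧
        (∀ θ : ℂ, |θ.re| < ε → ‖V θ‖ ≤ C * Real.exp (Nₑ * |θ.im|)) ∧
        ∀ θ : ℝ, |θ| < ε → ∀ hθ : IsTimeOrdered (linActMulti (planeRot (0 : Fin 3) θ) F),
          V θ = h.fieldVec N (fun _ => ()) (linActMulti (planeRot (0 : Fin 3) θ) F) hθ)
    (X : 𝓢((Fin N → E4), ℂ)) (hXc : HasCompactSupport (X : (Fin N → E4) → ℂ))
    (hXs : tsupport (X : (Fin N → E4) → ℂ) ⊆ {x | ∀ i j : Fin N, i ≠ j → x i 0 ≠ x j 0}) :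
    ∃ ε : ℝ, 0 < ε ∧ ∃ (Φ : ℂ → ℂ) (C : ℝ), DifferentiableOn ℂ Φ {w : ℂ | |w.re| < ε} ∧
      (∀ w : ℂ, |w.re| < ε → ‖Φ w‖ ≤ C * Real.exp (Nₑ * |w.im|)) ∧
      ∀ θ : ℝ, |θ| < ε → Φ θ = S₁ N (linActMulti (planeRot (0 : Fin 3) θ) X) := by
  obtain ⟨Xs, hsum, hXs'⟩ := exists_chamber_pieces X hXc hXs
  have hpiece := fun σ => local_piece h hsym hV σ (Xs σ) (hXs' σ).1 (hXs' σ).2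
  choose ε hε Φ C hd hg hf using hpiece
  have hne : (Finset.univ : Finset (Equiv.Perm (Fin N))).Nonempty := ⟨1, Finset.mem_univ _⟩
  set ε₀ : ℝ := Finset.univ.inf' hne ε with hε₀
  have hε₀le : ∀ σ, ε₀ ≤ ε σ := fun σ => Finset.inf'_le _ (Finset.mem_univ σ)
  refine ⟨ε₀, (Finset.lt_inf'_iff hne).2 fun σ _ => hε σ, fun w => ∑ σ, Φ σ w, ∑ σ, C σ, ?_, ?_, ?_⟩
  · exact DifferentiableOn.fun_sum fun σ _ => (hd σ).mono fun w hw => lt_of_lt_of_le hw (hε₀le σ)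
  · intro w hw
    calc ‖∑ σ, Φ σ w‖ ≤ ∑ σ, ‖Φ σ w‖ := norm_sum_le _ _
      _ ≤ ∑ σ, C σ * Real.exp (Nₑ * |w.im|) :=
          Finset.sum_le_sum fun σ _ => hg σ w (lt_of_lt_of_le hw (hε₀le σ))
      _ = (∑ σ, C σ) * Real.exp (Nₑ * |w.im|) := by rw [Finset.sum_mul]
  · intro θ hθ
    calc ∑ σ, Φ σ θ = ∑ σ, S₁ N (linActMulti (planeRot (0 : Fin 3) θ) (Xs σ)) :=
          Finset.sum_congr rfl fun σ _ => hf σ θ (lt_of_lt_of_le hθ (hε₀le σ))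
      _ = S₁ N (linActMulti (planeRot (0 : Fin 3) θ) (∑ σ, Xs σ)) := by rw [map_sum, map_sum]
      _ = S₁ N (linActMulti (planeRot (0 : Fin 3) θ) X) := by rw [← hsum]

end OrbitBandlimitLocal

/-- **Stub 3d — LOCAL ORBIT CONTINUATION FROM BOOST VECTORS (`e₀`-frame, angle `0`), the registered signature
VERBATIM.**  For a one-species family with E2 along `e₀`, translations and E3, uniform planar boost vectors (as a
hypothesis) give, in every degree `N`, a type `Nₑ` such that the orbit function of every compactly supported `X` with
`e₀`-generic support extends holomorphically near the angle `0` with type `Nₑ` (chamber decomposition + E3 +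
translations + vacuum pairing; `OrbitBandlimitLocal.localOrbitContinuation_main`). -/
theorem stub_orbitLocalContinuation :
    open Literature.MathematicalPhysics.QuantumLattice Literature.MathematicalPhysics.AQFT
      Literature.MathematicalPhysics.QuantumFieldTheory
      Summit.QuantumFields.YangMills.Theorems.CurvatureBoostCovariance.Negative
      Summit.QuantumFields.YangMills.Theorems.NPointIsotropy.Negative in
    ∀ (S₁ : SchwingerFamily E4) (h : OSReconstructionNoE1 S₁.toLabelled), S₁.toLabelled.IsSymmetric →
      (∀ (n : ℕ), ∃ N : ℝ, ∀ (F : SchwartzMap (Fin n → E4) ℂ), IsTimeOrdered F →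
        HasCompactSupport (F : (Fin n → E4) → ℂ) →
        ∃ ε : ℝ, 0 < ε ∧ ∃ (V : ℂ → h.Hilbert) (C : ℝ),
          DifferentiableOn ℂ V {θ : ℂ | |θ.re| < ε} ∧
          (∀ θ : ℂ, |θ.re| < ε → ‖V θ‖ ≤ C * Real.exp (N * |θ.im|)) ∧
          ∀ θ : ℝ, |θ| < ε → ∀ hθ : IsTimeOrdered (linActMulti (planeRot (0 : Fin 3) θ) F),
            V θ = h.fieldVec n (fun _ => ()) (linActMulti (planeRot (0 : Fin 3) θ) F) hθ) →
      ∀ (N : ℕ), ∃ Nₑ : ℝ, ∀ (X : SchwartzMap (Fin N → E4) ℂ), HasCompactSupport (X : (Fin N → E4) → ℂ) →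
        tsupport (X : (Fin N → E4) → ℂ) ⊆ {x | ∀ i j : Fin N, i ≠ j → x i 0 ≠ x j 0} →
        ∃ ε : ℝ, 0 < ε ∧ ∃ (Φ : ℂ → ℂ) (C : ℝ),
          DifferentiableOn ℂ Φ {w : ℂ | |w.re| < ε} ∧
          (∀ w : ℂ, |w.re| < ε → ‖Φ w‖ ≤ C * Real.exp (Nₑ * |w.im|)) ∧
          ∀ θ : ℝ, |θ| < ε → Φ θ = S₁ N (linActMulti (planeRot (0 : Fin 3) θ) X) := by
  intro S₁ h hsym hV N
  obtain ⟨Nₑ, hVN⟩ := hV N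
  exact ⟨Nₑ, fun X hXc hXs => OrbitBandlimitLocal.localOrbitContinuation_main h hsym hVN X hXc hXs⟩

end Summit.QuantumFields.YangMills.Theorems.CurvatureBoostCovariance.BoostsInheritMirrors

end
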